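import Summits.Ventures.Crystal3D.Theorems.StickyWulffConstantNoReconstructionGainLowCoordRim
import Summits.Ventures.Crystal3D.Theorems.StickyWulffConstantNoReconstructionGainLatticeAdhesion
import Literature.Geometry.DiscreteGeometry.KissingNumberThreeProofs
import HarnessLib

/-!
# The low-coordination adhesion atom at `(111)`: `LowCoordAdhesion111 9`

HONEST FRAMING. Part of the venture `Summits/Ventures/Crystal3D` (cell `crystal3d-full`), helper
`--supports` the crux `NoReconstructionGain` (stmt-Ventures-19144, route
`route-Ventures-StickyWulffConstant`).  This is the RUNG TARGET of the planner's WK line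
(p1 gen 12, `Cruxes/…/WeightedKissing.lean`: `LowCoordAdhesion111 9`), proved: the registered
atom `stub_adhesion` (cross contacts between the slab sample `P` and the rest `Q = X \ P` are at
most `D(Q) + C ρ`) at the normal `ν = e₃`, for EVERY unit packing whose non-sample balls have AT
MOST NINE contacts — all monolayer-type adsorbates (`3` substrate + `≤ 6` lateral), adatom
gases, amorphous / rumpled / OBLIQUE wetting layers, with NO bond-angle hypothesis (incomparable
with the steep-or-flat rungs of `…SteepFlatNoGain.lean`; both contain the registered monolayers).

**Theorem** (`lowCoordAdhesion111_nine`, `R = 4`, `C = 450 π`): for `ρ ≥ R`, `X ⊇ P` a finite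
unit packing, `P` = all sites of `fccStacking 1 √(2/3)` with `−2R ≤ ⟪p, e₃⟫ ≤ −R` and
`‖p‖² − ⟪p, e₃⟫² ≤ ρ²`, and every `q ∈ X \ P` touching at most nine balls of `X`:
`#{(p, q) ∈ P × (X \ P) : dist p q = 1} ≤ contactDeficiency (X \ P) + C ρ`.

**Proof** (the planner's reduction, with the SLAB potential instead of `dist(·, conv P)`).
`Φ(y) = max (y₂ + 5h, −9h − y₂, 0)` (`h = √(2/3)`; `P` is the five layers `k = −9..−5`).  Pair
weights `w(q → x) = 2, 1, 0` according as `Φ x − Φ q ≤ −h`, `∈ (−h, h)`, `≥ h`; `w(q→x) + w(x→q)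
= 2`, so `Σ_{q ∈ Q} Σ_{x ∼ q} w = orderedContacts Q + Σ_cross w(q → p)`, and `w(q → p) = 2`
unless `Φ q < h`, which happens only at RIM sites `p` (`rim_of_lowPotential_partner`: hollow
positions over the disc interior, no room inside the slab), i.e. on `≤ 12 · #rim ≤ 900 π ρ` cross
bonds (kissing number twelve, `card_rim_le`).  Per ball, `Σ_{x ∼ q} w ≤ #N(q) + #steep ≤ 9 + 3`
(`card_steepPartners_le_three`, the cone lemma).  Hence `2·cross − 900πρ ≤ 12 #Q −
orderedContacts Q = 2 D(Q)`.

WHAT THIS IS NOT: the atom for coordination `10, 11, 12` (spherical-code lemmas `K10`/`K11` open;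
`12` impossible by a local rule — the WK no-go); other normals; rung F-C1 not moved.
-/

noncomputable section

namespace Summit.Ventures.Crystal3D.Theorems

open Summit.Ventures.Crystal3D Finset Real
open Literature.MathematicalPhysics.StatisticalMechanics (barlowPos barlowStacking fccStacking
  constHagg barlowPos_apply_two orderedContacts contactDeficiency)
open Literature.Geometry.DiscreteGeometry (musin2006_kissing_three_holds)
open scoped InnerProductSpace

/-- **Kissing bound for partners.** In a unit packing `X`, every point `p` has at most twelve
partners at distance exactly `1` (the kissing number in three dimensions, tree theorem
`musin2006_kissing_three_holds`). -/
theorem card_partners_le_twelve (X : Finset (EuclideanSpace ℝ (Fin 3)))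
    (hX : ∀ p ∈ X, ∀ q ∈ X, p ≠ q → 1 ≤ dist p q) (p : EuclideanSpace ℝ (Fin 3)) :
    (X.filter fun x => dist p x = 1).card ≤ 12 := by
  classical
  have hinj : Set.InjOn (fun x : EuclideanSpace ℝ (Fin 3) => x - p)
      ↑(X.filter fun x => dist p x = 1) := fun x _ y _ hxy => sub_left_injective hxy
  rw [← card_image_of_injOn hinj]
  refine musin2006_kissing_three_holds _ ?_ ?_
  · intro v hv
    obtain ⟨x, hx, rfl⟩ := mem_image.1 hv
    rw [← dist_eq_norm, dist_comm]; exact (mem_filter.1 hx).2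
  · intro v hv w hw hvw
    obtain ⟨x, hx, rfl⟩ := mem_image.1 hv
    obtain ⟨y, hy, rfl⟩ := mem_image.1 hw
    rw [dist_eq_norm, sub_sub_sub_cancel_right, ← dist_eq_norm]
    exact hX x (mem_filter.1 hx).1 y (mem_filter.1 hy).1 fun h => hvw (by rw [h])

/-- Heights of sample sites: a site of `fccStacking 1 √(2/3)` with `−8 ≤ z ≤ −4` lies in one of
the layers `k = −9, …, −5`, so `−9h ≤ z ≤ −5h`. -/
theorem slab_height_bounds {p : EuclideanSpace ℝ (Fin 3)}
    (hΛ : p ∈ fccStacking 1 (Real.sqrt (2 / 3))) (h1 : -8 ≤ p 2) (h2 : p 2 ≤ -4) :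
    -(9 * Real.sqrt (2 / 3)) ≤ p 2 ∧ p 2 ≤ -(5 * Real.sqrt (2 / 3)) := by
  obtain ⟨hh2, hh45, hh89⟩ := sqrt_two_thirds_bounds
  obtain ⟨k, i, j, rfl⟩ := hΛ
  rw [barlowPos_apply_two] at h1 h2 ⊢
  have hk1 : -9 ≤ k := by
    by_contra hk
    have : (k : ℝ) ≤ -10 := by exact_mod_cast (show k ≤ -10 by omega)
    nlinarith
  have hk2 : k ≤ -5 := by
    by_contra hk
    have : (-4 : ℝ) ≤ k := by exact_mod_cast (show -4 ≤ k by omega)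
    nlinarith
  have hk1' : (-9 : ℝ) ≤ k := by exact_mod_cast hk1
  have hk2' : (k : ℝ) ≤ -5 := by exact_mod_cast hk2
  constructor <;> nlinarith

/-- **`LowCoordAdhesion111 9`** — the adhesion atom at `ν = e₃` for all overlayers of coordination
at most nine.  With `R = 4`, `C = 450π`: for `ρ ≥ R`, every finite unit packing `X ⊇ P`, `P` the
fcc `(111)` slab sample (`−2R ≤ ⟪p, e₃⟫ ≤ −R`, `‖p‖² − ⟪p, e₃⟫² ≤ ρ²`), such that every ball of
`X \ P` touches at most nine balls of `X`:
`#{(p, q) ∈ P × (X \ P) : dist p q = 1} ≤ contactDeficiency (X \ P) + C ρ`. -/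
theorem lowCoordAdhesion111_nine :
    ∃ R C : ℝ, 1 ≤ R ∧ ∀ ρ : ℝ, R ≤ ρ → ∀ X P : Finset (EuclideanSpace ℝ (Fin 3)),
      (∀ p ∈ X, ∀ q ∈ X, p ≠ q → 1 ≤ dist p q) → P ⊆ X →
      (∀ p, p ∈ P ↔ (p ∈ fccStacking 1 (Real.sqrt (2 / 3)) ∧
        -(2 * R) ≤ ⟪p, EuclideanSpace.single (2 : Fin 3) (1 : ℝ)⟫_ℝ ∧
        ⟪p, EuclideanSpace.single (2 : Fin 3) (1 : ℝ)⟫_ℝ ≤ -R ∧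
        ‖p‖ ^ 2 - ⟪p, EuclideanSpace.single (2 : Fin 3) (1 : ℝ)⟫_ℝ ^ 2 ≤ ρ ^ 2)) →
      (∀ q ∈ X \ P, (X.filter fun x => dist q x = 1).card ≤ 9) →
      ((((P ×ˢ (X \ P)).filter fun pq => dist pq.1 pq.2 = 1).card : ℕ) : ℝ) ≤
        contactDeficiency (X \ P) + C * ρ := by
  classical
  refine ⟨4, 450 * Real.pi, by norm_num, ?_⟩
  intro ρ hρ X P hX hPX hP hdeg
  obtain ⟨hh2, hh45, hh89⟩ := sqrt_two_thirds_bounds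
  set h : ℝ := Real.sqrt (2 / 3) with hhdef
  have hhpos : 0 < h := by linarith
  -- the sample in coordinates
  have hinner : ∀ p : EuclideanSpace ℝ (Fin 3), ⟪p, EuclideanSpace.single (2 : Fin 3) (1 : ℝ)⟫_ℝ = p 2 :=
    fun p => by simp [EuclideanSpace.inner_single_right]
  have hlat : ∀ p : EuclideanSpace ℝ (Fin 3), ‖p‖ ^ 2 - (p 2) ^ 2 = p 0 ^ 2 + p 1 ^ 2 := fun p => by
    rw [EuclideanSpace.real_norm_sq_eq, Fin.sum_univ_three]; ring
  have hP' : ∀ p, p ∈ P ↔ (p ∈ fccStacking 1 (Real.sqrt (2 / 3)) ∧ -8 ≤ p 2 ∧ p 2 ≤ -4 ∧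
      p 0 ^ 2 + p 1 ^ 2 ≤ ρ ^ 2) := by
    intro p
    rw [hP p, hinner, hlat]
    constructor
    · rintro ⟨a, b, c, d⟩; exact ⟨a, by linarith, by linarith, d⟩
    · rintro ⟨a, b, c, d⟩; exact ⟨a, by linarith, by linarith, d⟩
  -- the slab potential and the weights
  set Φ : EuclideanSpace ℝ (Fin 3) → ℝ := fun y => max (y 2 + 5 * h) (max (-(9 * h) - y 2) 0)
    with hΦdef
  have hΦ : ∀ y, Φ y = max (y 2 + 5 * h) (max (-(9 * h) - y 2) 0) := fun y => rfl
  have hΦ0 : ∀ y, 0 ≤ Φ y := fun y => le_trans (le_max_right _ _) (le_max_right _ _)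
  have hΦP : ∀ p ∈ P, Φ p = 0 := by
    intro p hp
    obtain ⟨hΛ, h1, h2, -⟩ := (hP' p).1 hp
    obtain ⟨hz1, hz2⟩ := slab_height_bounds hΛ h1 h2
    rw [hΦ, max_eq_right (le_trans (by linarith) (le_max_right _ _)), max_eq_right (by linarith)]
  set w : EuclideanSpace ℝ (Fin 3) → EuclideanSpace ℝ (Fin 3) → ℝ := fun q x =>
    if Φ x - Φ q ≤ -h then 2 else if Φ x - Φ q < h then 1 else 0 with hwdef
  have hw_symm : ∀ q x, w q x + w x q = 2 := by
    intro q x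
    simp only [hwdef]
    have e : Φ q - Φ x = -(Φ x - Φ q) := by ring
    rw [e]
    rcases le_or_gt (Φ x - Φ q) (-h) with h1 | h1
    · rw [if_pos h1, if_neg (by linarith), if_neg (by linarith)]; norm_num
    · rw [if_neg (not_le.2 h1)]
      rcases lt_or_ge (Φ x - Φ q) h with h2 | h2
      · rw [if_pos h2, if_neg (by linarith), if_pos (by linarith)]; norm_num
      · rw [if_neg (not_lt.2 h2), if_pos (by linarith)]; norm_num
  set Q := X \ P with hQ
  have hQX : ∀ q ∈ Q, q ∈ X ∧ q ∉ P := fun q hq => mem_sdiff.1 hq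
  -- (1) per-ball bound
  have hball : ∀ q ∈ Q, ∑ x ∈ X, (if dist q x = 1 then w q x else 0) ≤ 12 := by
    intro q hq
    set N := X.filter fun x => dist q x = 1 with hN
    set A := X.filter fun x => dist q x = 1 ∧ Φ x - Φ q ≤ -h with hA
    have hA3 : A.card ≤ 3 := card_steepPartners_le_three X hX q Φ hΦ
    have hN9 : N.card ≤ 9 := hdeg q hq
    have hAN : A = N.filter fun x => Φ x - Φ q ≤ -h := by
      rw [hA, hN, filter_filter]
    rw [← sum_filter]
    have hpt : ∀ x ∈ N, w q x ≤ (if Φ x - Φ q ≤ -h then 1 else 0) + 1 := by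
      intro x _
      simp only [hwdef]
      split_ifs <;> norm_num
    calc ∑ x ∈ N, w q x ≤ ∑ x ∈ N, ((if Φ x - Φ q ≤ -h then (1 : ℝ) else 0) + 1) := sum_le_sum hpt
      _ = (A.card : ℝ) + N.card := by
          rw [sum_add_distrib, sum_boole, sum_const, hAN]; simp
      _ ≤ 12 := by
          have h1 : (A.card : ℝ) ≤ 3 := by exact_mod_cast hA3
          have h2 : (N.card : ℝ) ≤ 9 := by exact_mod_cast hN9
          linarith
  have h12 : ∑ q ∈ Q, ∑ x ∈ X, (if dist q x = 1 then w q x else 0) ≤ 12 * (Q.card : ℝ) := by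
    calc ∑ q ∈ Q, ∑ x ∈ X, (if dist q x = 1 then w q x else 0) ≤ ∑ _q ∈ Q, (12 : ℝ) :=
          sum_le_sum hball
      _ = 12 * (Q.card : ℝ) := by rw [sum_const, nsmul_eq_mul, mul_comm]
  -- (2) split the inner sum over `X = Q ∪ P`
  have hXQP : X = Q ∪ P := by rw [hQ, sdiff_union_of_subset hPX]
  have hdisj : Disjoint Q P := by rw [hQ]; exact sdiff_disjoint
  have hsplit : ∑ q ∈ Q, ∑ x ∈ X, (if dist q x = 1 then w q x else 0) =
      (∑ q ∈ Q, ∑ x ∈ Q, (if dist q x = 1 then w q x else 0)) +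
        ∑ q ∈ Q, ∑ p ∈ P, (if dist q p = 1 then w q p else 0) := by
    rw [← sum_add_distrib]
    refine sum_congr rfl fun q _ => ?_
    rw [hXQP, sum_union hdisj]
  -- (2a) the `Q`-`Q` part is `orderedContacts Q`
  have hQQ : ∑ q ∈ Q, ∑ x ∈ Q, (if dist q x = 1 then w q x else 0) = (orderedContacts Q : ℝ) := by
    set S := ∑ q ∈ Q, ∑ x ∈ Q, (if dist q x = 1 then w q x else 0) with hS
    have hS' : S = ∑ q ∈ Q, ∑ x ∈ Q, (if dist q x = 1 then w x q else 0) := by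
      rw [hS, sum_comm]
      refine sum_congr rfl fun x _ => sum_congr rfl fun q _ => ?_
      rw [dist_comm]
    have hsum2 : (∑ q ∈ Q, ∑ x ∈ Q, (if dist q x = 1 then w q x else 0)) +
        (∑ q ∈ Q, ∑ x ∈ Q, (if dist q x = 1 then w x q else 0)) =
        ∑ q ∈ Q, ∑ x ∈ Q, (if dist q x = 1 then (2 : ℝ) else 0) := by
      rw [← sum_add_distrib]
      refine sum_congr rfl fun q _ => ?_
      rw [← sum_add_distrib]
      refine sum_congr rfl fun x _ => ?_
      by_cases hqx : dist q x = 1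
      · rw [if_pos hqx, if_pos hqx, if_pos hqx]; exact hw_symm q x
      · rw [if_neg hqx, if_neg hqx, if_neg hqx]; norm_num
    have h2S : 2 * S = ∑ q ∈ Q, ∑ x ∈ Q, (if dist q x = 1 then (2 : ℝ) else 0) := by
      rw [two_mul, ← hsum2, ← hS', hS]
    rw [orderedContacts_eq_sum_sum]
    have : ∑ q ∈ Q, ∑ x ∈ Q, (if dist q x = 1 then (2 : ℝ) else 0) =
        2 * ∑ q ∈ Q, ∑ x ∈ Q, (if dist q x = 1 then (1 : ℝ) else 0) := by
      rw [mul_sum]; refine sum_congr rfl fun q _ => ?_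
      rw [mul_sum]; refine sum_congr rfl fun x _ => ?_
      split_ifs <;> norm_num
    linarith
  -- (2b) the cross part: weight `2` except at rim sites
  set rim := P.filter fun p => (ρ - 2) ^ 2 < p 0 ^ 2 + p 1 ^ 2 with hrim
  have hwP : ∀ q ∈ Q, ∀ p ∈ P, dist q p = 1 →
      (2 : ℝ) - (if p ∈ rim then 1 else 0) ≤ w q p := by
    intro q hq p hp hqp
    have hΦp := hΦP p hp
    show (2 : ℝ) - (if p ∈ rim then 1 else 0) ≤
      (if Φ p - Φ q ≤ -h then 2 else if Φ p - Φ q < h then 1 else 0)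
    rw [hΦp, zero_sub]
    by_cases hge : h ≤ Φ q
    · rw [if_pos (show -Φ q ≤ -h by linarith)]
      by_cases hpr : p ∈ rim
      · rw [if_pos hpr]; norm_num
      · rw [if_neg hpr]; norm_num
    · have hlt := not_le.1 hge
      rw [if_neg (show ¬ (-Φ q ≤ -h) from not_le.2 (by linarith)),
        if_pos (show -Φ q < h by linarith [hΦ0 q])]
      have hprim : p ∈ rim := by
        rw [hrim, mem_filter]
        refine ⟨hp, ?_⟩
        exact rim_of_lowPotential_partner ρ hρ X P hX hPX hP' Φ hΦ p q (hQX q hq).1 (hQX q hq).2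
          (by rw [dist_comm]; exact hqp) hlt
      rw [if_pos hprim]; norm_num
  have hcross : ((((P ×ˢ Q).filter fun pq => dist pq.1 pq.2 = 1).card : ℕ) : ℝ) =
      ∑ q ∈ Q, ∑ p ∈ P, (if dist q p = 1 then (1 : ℝ) else 0) := by
    rw [card_crossContacts_eq_sum_sum, sum_comm]
    refine sum_congr rfl fun q _ => sum_congr rfl fun p _ => ?_
    rw [dist_comm]
  have hrim12 : ∑ q ∈ Q, ∑ p ∈ P, (if dist q p = 1 then (if p ∈ rim then (1 : ℝ) else 0) else 0)
      ≤ 12 * (rim.card : ℝ) := by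
    rw [sum_comm]
    have hz : ∀ p ∈ P, p ∉ rim →
        ∑ q ∈ Q, (if dist q p = 1 then (if p ∈ rim then (1 : ℝ) else 0) else 0) = 0 := by
      intro p _ hpr
      exact sum_eq_zero fun q _ => by simp [hpr]
    rw [← sum_filter_add_sum_filter_not P (fun p => p ∈ rim), sum_congr rfl (fun p hp =>
      hz p (mem_filter.1 hp).1 (mem_filter.1 hp).2), sum_const_zero, add_zero]
    have hPr : P.filter (fun p => p ∈ rim) = rim := by
      ext p; rw [mem_filter, hrim, mem_filter]; tauto
    rw [hPr]
    have hle : ∀ p ∈ rim, ∑ q ∈ Q, (if dist q p = 1 then (if p ∈ rim then (1 : ℝ) else 0) else 0)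
        ≤ 12 := by
      intro p hpr
      have hpX : p ∈ X := hPX (mem_filter.1 hpr).1
      calc ∑ q ∈ Q, (if dist q p = 1 then (if p ∈ rim then (1 : ℝ) else 0) else 0)
          = ∑ q ∈ Q, (if dist p q = 1 then (1 : ℝ) else 0) := by
            refine sum_congr rfl fun q _ => ?_
            rw [if_pos hpr, dist_comm]
        _ = ((Q.filter fun q => dist p q = 1).card : ℝ) := by rw [sum_boole]
        _ ≤ ((X.filter fun q => dist p q = 1).card : ℝ) := by
            exact_mod_cast card_le_card (filter_subset_filter _ (by rw [hQ]; exact sdiff_subset))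
        _ ≤ 12 := by exact_mod_cast card_partners_le_twelve X hX p
    calc ∑ p ∈ rim, ∑ q ∈ Q, (if dist q p = 1 then (if p ∈ rim then (1 : ℝ) else 0) else 0)
        ≤ ∑ _p ∈ rim, (12 : ℝ) := sum_le_sum hle
      _ = 12 * (rim.card : ℝ) := by rw [sum_const, nsmul_eq_mul, mul_comm]
  have hQP : 2 * ((((P ×ˢ Q).filter fun pq => dist pq.1 pq.2 = 1).card : ℕ) : ℝ) -
      12 * (rim.card : ℝ) ≤ ∑ q ∈ Q, ∑ p ∈ P, (if dist q p = 1 then w q p else 0) := by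
    rw [hcross, mul_sum]
    have hpt : ∀ q ∈ Q, 2 * ∑ p ∈ P, (if dist q p = 1 then (1 : ℝ) else 0) -
        ∑ p ∈ P, (if dist q p = 1 then (if p ∈ rim then (1 : ℝ) else 0) else 0) ≤
        ∑ p ∈ P, (if dist q p = 1 then w q p else 0) := by
      intro q hq
      rw [mul_sum, ← sum_sub_distrib]
      refine sum_le_sum fun p hp => ?_
      by_cases hqp : dist q p = 1
      · rw [if_pos hqp, if_pos hqp, if_pos hqp]
        have := hwP q hq p hp hqp; linarith
      · rw [if_neg hqp, if_neg hqp, if_neg hqp]; norm_num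
    have := sum_le_sum hpt
    rw [sum_sub_distrib] at this
    linarith [hrim12]
  -- (3) assemble
  have hrimle : (rim.card : ℝ) ≤ 75 * Real.pi * ρ := card_rim_le ρ hρ P hP'
  have hmain : (orderedContacts Q : ℝ) +
      (2 * ((((P ×ˢ Q).filter fun pq => dist pq.1 pq.2 = 1).card : ℕ) : ℝ) -
        12 * (rim.card : ℝ)) ≤ 12 * (Q.card : ℝ) := by
    rw [← hQQ]; linarith [hsplit, h12, hQP]
  show ((((P ×ˢ Q).filter fun pq => dist pq.1 pq.2 = 1).card : ℕ) : ℝ) ≤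
    contactDeficiency Q + 450 * Real.pi * ρ
  unfold contactDeficiency
  nlinarith [hmain, hrimle, Real.pi_pos]

end Summit.Ventures.Crystal3D.Theorems

end
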